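import Summits.QuantumFields.BalabanUV.T4Continuum.Support.NE9FutureProfileEndOfRecordSharp
import Summits.QuantumFields.BalabanUV.T4Continuum.Support.NE9StateLinftyEquiv

/-!
# NE9FutureProfileEndOfRecordSP — route R4's END OF RECORD for an ARBITRARY CHAIN ESTIMATE of the ambient step, and the
# R4♯ «POLYDISC SCHWARZ–PICK» instances: `NE9 ∧ FadingMemory` at the SHARP rate `θ` with prefactor `1∕(1−θ²)` (any reading
# constant `τ₀`; and `τ₀ := τ̄` with the room `ω̂·r + τ̄·B₀ ≤ θ·r`)

Cell `pub-balaban`, T4-DAG §6 NE9; NE9 crux team (coordinator ruling «YM REDIRECT» e34b3e0c (2)); leaf lineage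
`b2b-balaban-t4-ne9-formalise-leaf-05` generation 47; route R4 ∕ R4♯ of `t4/ROUTES-NE9.md` v7.  Filed on the BINDER-row OWNER's word
(lineage `b2b-balaban-t4-ne9-p1` gen 60, CLAIMS.log 2026-08-21T08:10:20Z «→ leaf-05: GO — the RECORD-level ♯-END
`Support/NE9FutureProfileEndOfRecordSP.lean` is yours … the owner lineage then re-docks D4∕D6 by one lemma name») and the refuter's
pricing (PRICING-NE9 v8 §B (B8-2): «EndSP ∕ EndOfRecordSP priced XS, GO»).  SIBLING of this lineage's `NE9FutureProfileEndOfRecordSharp`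
(p255390: `orbit_of_record_injRead`, `ne9_and_fadingMemory_of_holoSlice_injRead` ∕ `_sharp` at the Earle–Hamilton rate `2θ∕(1+θ)`,
prefactor `2∕(1−θ)`), whose §2 proof is REPEATED here ONCE with the chain estimate of the ambient step left as a HYPOTHESIS
(K2♭'s generic END `NE9FutureProfileEnd.ne9_and_fadingMemory_futureInfluence` accepts ANY `ChainLipschitz`), and then instantiated
at the polydisc Schwarz–Pick chain of leaf lineage `…-leaf-03` gen 41 (`NE9PolydiscChain.chainLipschitz_of_holoSelfMaps_polydisc`,
p255595, on the docking isometry `NE9StateLinftyEquiv.stateLinftyEquiv`, p255793 — the kernel of `t4-ne9-idea-1` gen 5) composed with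
K2♭'s `NE9FutureProfileStep.holoSelfMaps_step`.  That composite IS, one level down (future-influence coordinates), leaf lineage
`…-leaf-04` gen 47's `NE9FutureProfileEndSP.ne9_and_fadingMemory_futureInfluence_SP` (p256290) — the K2♭-level ♯-END; this file is
its RECORD-level twin and cites the same two tree lemmas by name (it does not import p256290, so neither file waits on the other).

HONEST FRAMING (T4-DAG PAGE 1).  Rung (B)+1 of the FINITE-VOLUME T⁴ programme — NOT infinite volume, NOT a mass gap, NOT the Clay
problem.  NE9 (`T4OutputRate.NE9` ∧ `FadingMemory`) is a cell NEW ESTIMATE, NOT PRINTED in [I] = [Balaban1987RG1] (CMP **109**), [II] =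
[Balaban1988RG2Cluster] (CMP **116**), and NOT PROVED for Bałaban's E^{(j)}: the theorems below are «NE9 ⇐ the named binders» for an
ABSTRACT functional `E` carrying EXACTLY the END of record's structural binders plus ONE complex slice map `ΦY` with the displayed
clauses (Φ-holo) ∕ (Φ-size) ∕ (Φ-real) — the INSTANCE ((R-0)[scope] on the box, the reality clause, the coupling half `hlast`:
owner's D4∕D6) and the model O-NE9-1 (wall W1) UNTOUCHED; spine PROVED 0∕9.  HONEST DEPENDENCY (cell line, verbatim): continuum YM
on T⁴ ⇐ BetaPertH ∧ nine spine estimates (0/9 proved); BetaPertH ⇐ (D1) ∧ (D4) ∧ CAP+tail; G-an2-4 gates asym, D1 and NE2/3/4.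
`FlowStep.BetaPertH`, (B), (B^μ) do not occur.  Bookkeeping and composition over generic kernels; no `def`, no Prop-valued
definition; [I]∕[II] for TYPES∕loci only (ABSOLUTE RULE).  0 sorry.  A sharper RATE inside a CONDITIONAL END is not progress on the
estimate itself.

* §1 **`ne9_and_fadingMemory_of_holoSlice_injRead_of_chain`** — the END of record for ANY reading constant `τ₀ > 0` (`hRd`) and ANY
  chain estimate `ChainLipschitz (step …) W r θ Cc kk` of the AMBIENT step built from `ΦY` and the injection `injRead (RdAmb …) …`:
  conclusion `NE9 E W κ (prodModuli (Cc·ℓ) (fun _ => kk)) ∧ FadingMemory (Cc·ℓ∕kk) kk (…)`.  (Φ-holo) is NOT a hypothesis here — it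
  enters only through the chain estimate; `θ > 0` is not needed either.  Proof = p255390 §2's (the owner's, generalised), verbatim
  up to the `key` step.  The Earle–Hamilton END `…_injRead` (p255390 §2) is §1 at `NE9EarleHamiltonChain.chainLipschitz_of_holoSelfMaps`
  (`Cc = 2∕(1−θ)`, `kk = 2θ∕(1+θ)`) — §4, an `example`, not re-declared.
* §2 **`ne9_and_fadingMemory_of_holoSlice_injRead_SP`** — p255390 §2's binder list VERBATIM and in the same order ⊢
  `NE9 E W κ (prodModuli (1∕(1−θ²)·ℓ) (fun _ => θ)) ∧ FadingMemory (1∕(1−θ²)·ℓ∕θ) θ (…)`: §1 at the polydisc chain.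
* §3 **`ne9_and_fadingMemory_of_holoSlice_sharp_SP`** — p255390 §3's binder list VERBATIM and in the same order (`τ₀ := τ̄`, room
  `ω̂·r + τ̄·B₀ ≤ θ·r`, `hRd := NE9ChannelReadingSharp.norm_RdAmb_le_geometric_sharp`) ⊢ the same ♯-moduli — THE ♯-END OF RECORD at
  which the owner's D4 `NE9HoloSliceOfFamily` ∕ D6 `NE9HoloFamilyVacuumSubtracted` re-dock by ONE lemma name
  (`…_of_holoSlice_sharp ↦ …_of_holoSlice_sharp_SP`; conclusion letters `2∕(1−θ) ↦ 1∕(1−θ²)`, `2θ∕(1+θ) ↦ θ`).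
* §4 junction `example`: the Earle–Hamilton END `…_injRead` (p255390 §2) IS §1 at `chainLipschitz_of_holoSelfMaps` ∘ `holoSelfMaps_step`
  (by `exact`; an `example` because the gate forbids re-declaring a landed statement).
* §5 arithmetic `example` at the room's print-letter READING (PRICING-NE9 v8 §B (B8-3), S = 24∕13, ω̂ = 1∕13: `θ = 15∕26`; EH rate
  `30∕41`, SP rate `15∕26`; prefactors `52∕11` vs `676∕451`) — a reading of [II] p. 8 l. 9–10, asserted of nothing.
DISGUISE TEST: an abstract functional with displayed binders, one slice map, one injection, one externally supplied chain estimate;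
no carriers of Bałaban's; not NE9.  WHAT THIS DOES NOT DO: discharge (Φ-holo)∕(Φ-size)∕(Φ-real)∕`hlast` (owner's D4∕D6 instance
clauses), touch W1, or change R4's LIFE region (alive iff the box has slack S > 1 — PRICING-NE9 v8 §B; only the rate moves,
`2θ∕(1+θ) ↦ θ`).

References (TYPES ∕ loci only): [Balaban1987RG1] T. Bałaban, CMP **109** (1987) 249–301 — (0.23) p. 256, (2.13) p. 268, (1.18)
p. 263; [Balaban1988RG2Cluster] T. Bałaban, CMP **116** (1988) 1–22 — (1.36) p. 9, p. 8 l. 9–10; [EH1970] C. J. Earle, R. S. Hamilton,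
Proc. Sympos. Pure Math. XVI (1970) 61–65; [FV1980] T. Franzoni, E. Vesentini, North-Holland Math. Studies 40 (1980) ch. V §5.
Summits-side NEW work (LEAN PLACEMENT RULE); imports this lineage's `NE9FutureProfileEndOfRecordSharp` and leaf-03's
`NE9StateLinftyEquiv` (→ `NE9PolydiscChain`) BY NAME; modifies nothing; 0 sorry.  Value = the END of record's rate letter moved
from `2θ∕(1+θ)` to `θ` and its chain estimate made a displayed parameter, NOT summit progress.
-/

noncomputable section

namespace Summit.QuantumFields.BalabanUV.T4Continuum.NE9FutureProfileEndOfRecordSP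

open Metric Set
open scoped BigOperators ENNReal
open Literature.MathematicalPhysics.QuantumFieldTheory.Balaban1983to89
open Literature.MathematicalPhysics.QuantumFieldTheory.Balaban1983to89.T4OutputRate
open Literature.MathematicalPhysics.QuantumFieldTheory.Balaban1983to89.T4HistoryLipschitzRecursion
open Literature.MathematicalPhysics.QuantumFieldTheory.Balaban1983to89.T4HistoryLipschitzOuter
open Summit.QuantumFields.BalabanUV.T4Continuum.NE9EarleHamiltonChain
open Summit.QuantumFields.BalabanUV.T4Continuum.NE9FutureProfileStep
open Summit.QuantumFields.BalabanUV.T4Continuum.NE9FutureProfileEnd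
open Summit.QuantumFields.BalabanUV.T4Continuum.NE9ChannelRealLinear
open Summit.QuantumFields.BalabanUV.T4Continuum.NE9SliceSpaceOfRecord
open Summit.QuantumFields.BalabanUV.T4Continuum.NE9ChannelReadingOfRecord
open Summit.QuantumFields.BalabanUV.T4Continuum.NE9ChannelReadingSharp
open Summit.QuantumFields.BalabanUV.T4Continuum.NE9TableReading
open Summit.QuantumFields.BalabanUV.T4Continuum.NE9FutureProfileRecordPrelim
open Summit.QuantumFields.BalabanUV.T4Continuum.NE9FutureProfileEndOfRecordSharp
open Summit.QuantumFields.BalabanUV.T4Continuum.NE9PolydiscChain (chainLipschitz_of_holoSelfMaps_polydisc)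
open Summit.QuantumFields.BalabanUV.T4Continuum.NE9StateLinftyEquiv (stateLinftyEquiv)

variable {C : Carriers} {Bg ι : Type}

section Record

variable [Nonempty ι] {E : Functional C Bg} {W : Set (ℕ → ℝ)} {Adm : Set (Bg → C.Dom → ℝ)}
  {T : ℕ → (ℕ → ℝ) → (Bg → C.Dom → ℝ) → ι → ℝ} {Ψ : ℕ → ℝ → (ι → ℝ) → Bg → C.Dom → ℝ}
  {κ : ℝ} {wt : ℕ → ι → ℝ} {τ : ℕ → ℕ → ℝ} {τbar ω ωh : ℝ}

/-! ## §1 THE END OF RECORD FOR AN ARBITRARY CHAIN ESTIMATE OF THE AMBIENT STEP (any reading constant) -/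

/-- **ROUTE R4's END OF RECORD, ARBITRARY READING CONSTANT AND ARBITRARY CHAIN ESTIMATE.**  The END of record's structural binders
(`h0` base-free histories — printed structure [I] (0.23) p. 256 —, `AdmissibleTerms`, `AdmRestrict`, `ChannelAdditive`, `ChannelLocal`,
`ChannelSizeAtStepNN` + `hτ`, `Factorises`, `LastCouplingLipschitz` + `hlam`, `hsmul`, `hne`, `hwt`, `hω`, `hωh`, `hωωh`), a reading
constant `τ₀ > 0` with `hRd : ‖RdAmb (j+n) j s‖ ≤ τ₀·ωⁿ`, the slice map's (Φ-size) `hΦb` and (Φ-real) `hreal`, the room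
`ω̂·r + τ₀·B₀ ≤ θ·r` (`θ < 1`), and ANY chain estimate `hchain : ChainLipschitz (step …) W r θ Cc kk` (`0 ≤ Cc`, `0 < kk`) of the
AMBIENT step built from `ΦY` and the injection `injRead (RdAmb …) …` give
`NE9 E W κ (prodModuli (Cc·ℓ) (fun _ => kk)) ∧ FadingMemory (Cc·ℓ∕kk) kk (…)`.  Proof = `NE9FutureProfileEndOfRecordSharp.
ne9_and_fadingMemory_of_holoSlice_injRead`'s (the owner's, generalised to `τ₀`) with K2♭'s GENERIC END
`ne9_and_fadingMemory_futureInfluence` fed by `hchain` in place of the Earle–Hamilton kernel: `coord := τ₀⁻¹ • coord κ U X`, `e₀ := 0`,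
`hΦlast` from `LastCouplingLipschitz` through (Φ-real) and `embR`, `hE` from `orbit_of_record_injRead` — `τ₀` CANCELS from the moduli.
(Φ-holo) is not a hypothesis: holomorphy enters only through `hchain`.  «NE9 ⇐ the named binders»: the instance clauses and W1 are
untouched.  [cite: Balaban1987RG1, (2.13) p.268; Balaban1988RG2Cluster, (1.36) p.9] -/
theorem ne9_and_fadingMemory_of_holoSlice_injRead_of_chain
    (h0 : ∀ g ∈ W, ∀ (U : Bg) (X : C.Dom), C.scale X = 0 → E g U X = 0)
    (hAdm : AdmissibleTerms E W Adm) (hres : AdmRestrict Adm) (hadd : ChannelAdditive Adm T) (hloc : ChannelLocal Adm T)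
    (hstep : ChannelSizeAtStepNN Adm T κ wt τ) (hfac : Factorises E W T Ψ) {lam : ℕ → ℝ}
    (hlast : LastCouplingLipschitz E W T Ψ κ lam)
    (hsmul : ∀ (c : ℝ), ∀ H ∈ Adm, c • H ∈ Adm) (hne : Adm.Nonempty) (hwt : ∀ m y, 0 < wt m y)
    (hτ : ∀ k j, j ≤ k → 0 ≤ τ k j ∧ τ k j ≤ τbar * ω ^ (k - j)) (hω : 0 ≤ ω) (hωh : 0 < ωh) (hωωh : ω ≤ ωh)
    {τ₀ : ℝ} (hτ₀pos : 0 < τ₀)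
    (hRd : ∀ (j n : ℕ), ∀ s ∈ W,
      ‖RdAmb (κ := κ) hadd hres hstep hAdm.2 hsmul hne hwt (τ_nonneg hτ) (j + n) j s‖ ≤ τ₀ * ω ^ n)
    {ΦY : ℕ → ℝ → lp (fun _ : ι => ℂ) ∞ → lp (fun _ : Bg × C.Dom => ℂ) ∞} {r B₀ θ ℓ Cc kk : ℝ} (hr : 0 < r)
    (hB₀ : 0 ≤ B₀) (hθ1 : θ < 1) (hℓ : 0 ≤ ℓ) (hCc : 0 ≤ Cc) (hkk : 0 < kk)
    (hΦb : ∀ k, ∀ g ∈ W, MapsTo (ΦY k (g k)) (ball (0 : lp (fun _ : ι => ℂ) ∞) r) (closedBall 0 B₀))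
    (hreal : ∀ k, ∀ g ∈ W, ∀ s ∈ W, reading (wt k) (T k s (E g)) ∈ ball (0 : lp (fun _ : ι => ℂ) ∞) r →
      ∀ (U : Bg) (X : C.Dom), (ΦY k (s k) (reading (wt k) (T k s (E g))) : Bg × C.Dom → ℂ) (U, X) =
        ((Real.exp (κ * C.d X) * restrictScale (k + 1) (Ψ k (s k) (T k s (E g))) U X : ℝ) : ℂ))
    (hroom : ωh * r + τ₀ * B₀ ≤ θ * r)
    (hchain : ChainLipschitz
      (step W ΦY (injRead (W := W) (RdAmb (κ := κ) hadd hres hstep hAdm.2 hsmul hne hwt (τ_nonneg hτ)) hτ₀pos.le hω hωh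
        hωωh hRd) τ₀ ωh) W r θ Cc kk)
    (hlam : ∀ k, lam k ≤ ℓ) :
    NE9 E W κ (prodModuli (Cc * ℓ) fun _ => kk) ∧
      FadingMemory (Cc * ℓ / kk) kk (prodModuli (Cc * ℓ) fun _ => kk) := by
  have hτ₀ne : (τ₀ : ℂ) ≠ 0 := by exact_mod_cast hτ₀pos.ne'
  set J := injRead (W := W) (RdAmb (κ := κ) hadd hres hstep hAdm.2 hsmul hne hwt (τ_nonneg hτ)) hτ₀pos.le hω hωh hωωh hRd
    with hJdef
  have hJ : ∀ k, ‖J k‖ ≤ τ₀ := fun k => norm_injRead_le _ hτ₀pos.le hω hωh hωωh hRd k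
  have hθr : θ * r < r := by nlinarith
  have he₀ : ‖(0 : lp (fun _ : Bg × C.Dom => ℂ) ∞ × Fut W (lp (fun _ : ι => ℂ) ∞))‖ ≤ θ * r := by
    rw [norm_zero]; nlinarith [mul_nonneg hτ₀pos.le hB₀, mul_pos hωh hr]
  -- the orbit identification, per history
  have horb := fun (g : ℕ → ℝ) (hg : g ∈ W) (k : ℕ) =>
    orbit_of_record_injRead h0 hAdm hres hadd hloc hstep hfac hsmul hne hwt hτ hω hωh hωωh hτ₀pos.le hRd hr hB₀ hθ1 hΦb
      hreal hroom hg k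
  -- the profile coordinate at `(0, s)` is the record's table, inside the ball
  have hF1 : ∀ g (hg : g ∈ W) (k : ℕ) (s : ℕ → ℝ) (hs : s ∈ W),
      (emb W ΦY J τ₀ ωh 0 k g).2 ⟨0, ⟨s, hs⟩⟩ = reading (wt k) (T k s (E g)) := by
    intro g hg k s hs
    have h1 := (horb g hg k).2.2 0 s hs
    have hT : T (k + 0) s (truncScale k (E g)) = T k s (E g) := by
      funext y; rw [Nat.add_zero]; exact (hloc k s (E g) (hAdm.1 g hg) y).symm
    rw [pow_zero, one_smul, hT] at h1
    simpa only [Nat.add_zero] using h1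
  have hF2 : ∀ g (hg : g ∈ W) (k : ℕ) (s : ℕ → ℝ) (hs : s ∈ W),
      reading (wt k) (T k s (E g)) ∈ ball (0 : lp (fun _ : ι => ℂ) ∞) r := by
    intro g hg k s hs
    rw [← hF1 g hg k s hs, mem_ball_zero_iff]
    exact lt_of_le_of_lt (((emb W ΦY J τ₀ ωh 0 k g).2.norm_coe_le_norm _).trans
      ((norm_snd_le _).trans (norm_emb_le (fun k g hg => mapsTo_step hτ₀pos.le hωh.le hΦb hJ hroom k hg) hθr
        he₀ k hg))) hθr
  -- the slice map at the record's tables is the embedded real slice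
  have hemb : ∀ g (hg : g ∈ W) (k : ℕ) (s : ℕ → ℝ) (hs : s ∈ W),
      (∀ (U : Bg) (X : C.Dom), |restrictScale (k + 1) (Ψ k (s k) (T k s (E g))) U X| ≤ Real.exp (-(κ * C.d X)) * B₀) ∧
      ΦY k (s k) (reading (wt k) (T k s (E g))) = embR κ (restrictScale (k + 1) (Ψ k (s k) (T k s (E g)))) := by
    intro g hg k s hs
    have h := eq_embR_of_coord (κ := κ) (hreal k g hg s hs (hF2 g hg k s hs))
    have hGB : ‖ΦY k (s k) (reading (wt k) (T k s (E g)))‖ ≤ B₀ :=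
      mem_closedBall_zero_iff.mp (hΦb k s hs (hF2 g hg k s hs))
    exact ⟨fun U X => (h.1 U X).trans (mul_le_mul_of_nonneg_left hGB (Real.exp_pos _).le), h.2⟩
  -- K2♭'s GENERIC END, fed by the supplied chain estimate
  have key := ne9_and_fadingMemory_futureInfluence (W := W) (Φ := ΦY) (J := J) (τ₀ := τ₀) (ωh := ωh) E 0
    (fun U X => ((τ₀⁻¹ : ℝ) : ℂ) • coord κ U X) (κ := κ) (cY := τ₀⁻¹) (lam := fun k => max (lam k) 0) hr hθ1 hCc hkk hℓ
    (inv_nonneg.mpr hτ₀pos.le) hτ₀pos.le hωh.le hΦb hJ hroom he₀ hchain ?_ (fun k => max_le (hlam k) hℓ) ?_ ?_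
  · have hc : τ₀⁻¹ * Cc * (τ₀ * ℓ) = Cc * ℓ := by field_simp
    rwa [hc] at key
  · -- hΦlast from `LastCouplingLipschitz`
    intro k g hg g' hg'
    rw [hF1 g hg k g hg, hF1 g hg k g' hg', (hemb g hg k g hg).2, (hemb g hg k g' hg').2,
      ← embR_sub (hemb g hg k g hg).1 (hemb g hg k g' hg').1]
    refine norm_embR_le (mul_nonneg (le_max_right _ _) (abs_nonneg _)) fun U X => ?_
    rw [Pi.sub_apply, Pi.sub_apply]
    by_cases hX : C.scale X = k + 1
    · rw [restrictScale_of_eq _ hX, restrictScale_of_eq _ hX]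
      exact (hlast g hg g' hg' k U X hX).trans (mul_le_mul_of_nonneg_left
        (mul_le_mul_of_nonneg_right (le_max_left _ _) (abs_nonneg _)) (Real.exp_pos _).le)
    · rw [restrictScale_of_ne _ hX, restrictScale_of_ne _ hX, sub_zero, abs_zero]; positivity
  · -- hcoord
    intro U X
    rw [norm_smul, Complex.norm_real, Real.norm_of_nonneg (inv_nonneg.mpr hτ₀pos.le)]
    exact mul_le_mul_of_nonneg_left (norm_coord_le κ U X) (inv_nonneg.mpr hτ₀pos.le)
  · -- hE from the orbit identification
    intro g hg U X
    rcases Nat.eq_zero_or_eq_succ_pred (C.scale X) with hX | hX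
    · rw [hX, emb_zero, Prod.fst_zero, map_zero, Complex.zero_re, h0 g hg U X hX]
    · set k := (C.scale X).pred with hk
      rw [hX, (horb g hg (k + 1)).2.1, _root_.smul_apply, map_smul, smul_smul, Complex.ofReal_inv,
        inv_mul_cancel₀ hτ₀ne, one_smul,
        coord_embR_re (N := B₀) (fun U X => ?_), restrictScale_of_eq _ hX]
      by_cases h' : C.scale X = k + 1
      · rw [restrictScale_of_eq _ h']; exact (horb g hg (k + 1)).1 U X h'.le
      · rw [restrictScale_of_ne _ h', abs_zero]; positivity

/-! ## §2 THE ♯-END OF RECORD, arbitrary reading constant (route R4♯: polydisc Schwarz–Pick chain) -/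

/-- **ROUTE R4♯'s END OF RECORD, ARBITRARY READING CONSTANT** — `NE9FutureProfileEndOfRecordSharp.ne9_and_fadingMemory_of_holoSlice_injRead`'s
binder list VERBATIM and in the same order (`h0`, `AdmissibleTerms`, `AdmRestrict`, `ChannelAdditive`, `ChannelLocal`,
`ChannelSizeAtStepNN` + `hτ`, `Factorises`, `LastCouplingLipschitz` + `hlam`, `hsmul`, `hne`, `hwt`, `hω`, `hωh`, `hωωh`, `0 < τ₀` + `hRd`,
(Φ-holo) `hΦd`, (Φ-size) `hΦb`, (Φ-real) `hreal`, `hr hB₀ hθ0 hθ1 hℓ`, room `ω̂·r + τ₀·B₀ ≤ θ·r`) ⊢ the SHARP moduli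
`NE9 E W κ (prodModuli (1∕(1−θ²)·ℓ) (fun _ => θ)) ∧ FadingMemory (1∕(1−θ²)·ℓ∕θ) θ (…)` (the Earle–Hamilton END reads `2∕(1−θ)`,
`2θ∕(1+θ)`): §1 at the polydisc Schwarz–Pick chain `NE9PolydiscChain.chainLipschitz_of_holoSelfMaps_polydisc` on the docking isometry
`NE9StateLinftyEquiv.stateLinftyEquiv (Bg × C.Dom) (Idx W) ι` (the ambient state space IS `ℓ^∞((Bg × C.Dom) ⊕ Idx W × ι; ℂ)`), with
`HoloSelfMaps` from K2♭'s `NE9FutureProfileStep.holoSelfMaps_step` — the same composite as leaf-04's K2♭-level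
`NE9FutureProfileEndSP.ne9_and_fadingMemory_futureInfluence_SP`.  «NE9 ⇐ the named binders».
[cite: Balaban1987RG1, (2.13) p.268; Balaban1988RG2Cluster, (1.36) p.9] -/
theorem ne9_and_fadingMemory_of_holoSlice_injRead_SP (h0 : ∀ g ∈ W, ∀ (U : Bg) (X : C.Dom), C.scale X = 0 → E g U X = 0)
    (hAdm : AdmissibleTerms E W Adm) (hres : AdmRestrict Adm) (hadd : ChannelAdditive Adm T) (hloc : ChannelLocal Adm T)
    (hstep : ChannelSizeAtStepNN Adm T κ wt τ) (hfac : Factorises E W T Ψ) {lam : ℕ → ℝ}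
    (hlast : LastCouplingLipschitz E W T Ψ κ lam)
    (hsmul : ∀ (c : ℝ), ∀ H ∈ Adm, c • H ∈ Adm) (hne : Adm.Nonempty) (hwt : ∀ m y, 0 < wt m y)
    (hτ : ∀ k j, j ≤ k → 0 ≤ τ k j ∧ τ k j ≤ τbar * ω ^ (k - j)) (hω : 0 ≤ ω) (hωh : 0 < ωh) (hωωh : ω ≤ ωh)
    {τ₀ : ℝ} (hτ₀pos : 0 < τ₀)
    (hRd : ∀ (j n : ℕ), ∀ s ∈ W,
      ‖RdAmb (κ := κ) hadd hres hstep hAdm.2 hsmul hne hwt (τ_nonneg hτ) (j + n) j s‖ ≤ τ₀ * ω ^ n)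
    {ΦY : ℕ → ℝ → lp (fun _ : ι => ℂ) ∞ → lp (fun _ : Bg × C.Dom => ℂ) ∞} {r B₀ θ ℓ : ℝ} (hr : 0 < r)
    (hB₀ : 0 ≤ B₀) (hθ0 : 0 < θ) (hθ1 : θ < 1) (hℓ : 0 ≤ ℓ)
    (hΦd : ∀ k, ∀ g ∈ W, DifferentiableOn ℂ (ΦY k (g k)) (ball (0 : lp (fun _ : ι => ℂ) ∞) r))
    (hΦb : ∀ k, ∀ g ∈ W, MapsTo (ΦY k (g k)) (ball (0 : lp (fun _ : ι => ℂ) ∞) r) (closedBall 0 B₀))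
    (hreal : ∀ k, ∀ g ∈ W, ∀ s ∈ W, reading (wt k) (T k s (E g)) ∈ ball (0 : lp (fun _ : ι => ℂ) ∞) r →
      ∀ (U : Bg) (X : C.Dom), (ΦY k (s k) (reading (wt k) (T k s (E g))) : Bg × C.Dom → ℂ) (U, X) =
        ((Real.exp (κ * C.d X) * restrictScale (k + 1) (Ψ k (s k) (T k s (E g))) U X : ℝ) : ℂ))
    (hroom : ωh * r + τ₀ * B₀ ≤ θ * r) (hlam : ∀ k, lam k ≤ ℓ) :
    NE9 E W κ (prodModuli (1 / (1 - θ ^ 2) * ℓ) fun _ => θ) ∧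
      FadingMemory (1 / (1 - θ ^ 2) * ℓ / θ) θ (prodModuli (1 / (1 - θ ^ 2) * ℓ) fun _ => θ) :=
  ne9_and_fadingMemory_of_holoSlice_injRead_of_chain h0 hAdm hres hadd hloc hstep hfac hlast hsmul hne hwt hτ hω hωh hωωh
    hτ₀pos hRd hr hB₀ hθ1 hℓ (one_div_nonneg.2 (by nlinarith)) hθ0 hΦb hreal hroom
    (chainLipschitz_of_holoSelfMaps_polydisc (stateLinftyEquiv (Bg × C.Dom) (Idx W) ι) hr hθ0 hθ1
      (holoSelfMaps_step hτ₀pos.le hωh.le hΦd hΦb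
        (fun k => norm_injRead_le _ hτ₀pos.le hω hωh hωωh hRd k) hroom))
    hlam

/-! ## §3 THE `√2`-FREE ♯-END OF RECORD (`τ₀ := τ̄`) — the owner's D4∕D6 re-dock here by one lemma name -/

/-- **ROUTE R4♯'s END OF RECORD WITH THE ROOM `ω̂·r + τ̄·B₀ ≤ θ·r`** — `NE9FutureProfileEndOfRecordSharp.
ne9_and_fadingMemory_of_holoSlice_sharp`'s binder list VERBATIM and in the same order ⊢ the SHARP moduli
`NE9 E W κ (prodModuli (1∕(1−θ²)·ℓ) (fun _ => θ)) ∧ FadingMemory (1∕(1−θ²)·ℓ∕θ) θ (…)`: §2 at `τ₀ := τ̄` with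
`hRd := NE9ChannelReadingSharp.norm_RdAmb_le_geometric_sharp` (F-R4-3 absent).  The owner's D4 `NE9HoloSliceOfFamily` ∕ D6
`NE9HoloFamilyVacuumSubtracted.ne9_and_fadingMemory_of_holoFamily_sharp` re-dock at THIS lemma by the one name swap
`ne9_and_fadingMemory_of_holoSlice_sharp ↦ ne9_and_fadingMemory_of_holoSlice_sharp_SP` (conclusion letters `2 / (1 - θ) ↦ 1 / (1 - θ ^ 2)`,
`2 * θ / (1 + θ) ↦ θ`).  In the refuter's letters (PRICING-NE9 v8 §B): R4's rate at the record becomes `θ = ω̂ + (1−ω̂)∕S` itself; life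
region (S > 1) unchanged.  «NE9 ⇐ the named binders».  [cite: Balaban1987RG1, (2.13) p.268; Balaban1988RG2Cluster, (1.36) p.9] -/
theorem ne9_and_fadingMemory_of_holoSlice_sharp_SP (h0 : ∀ g ∈ W, ∀ (U : Bg) (X : C.Dom), C.scale X = 0 → E g U X = 0)
    (hAdm : AdmissibleTerms E W Adm) (hres : AdmRestrict Adm) (hadd : ChannelAdditive Adm T) (hloc : ChannelLocal Adm T)
    (hstep : ChannelSizeAtStepNN Adm T κ wt τ) (hfac : Factorises E W T Ψ) {lam : ℕ → ℝ}
    (hlast : LastCouplingLipschitz E W T Ψ κ lam)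
    (hsmul : ∀ (c : ℝ), ∀ H ∈ Adm, c • H ∈ Adm) (hne : Adm.Nonempty) (hwt : ∀ m y, 0 < wt m y)
    (hτ : ∀ k j, j ≤ k → 0 ≤ τ k j ∧ τ k j ≤ τbar * ω ^ (k - j)) (hτbar : 0 < τbar) (hω : 0 ≤ ω) (hωh : 0 < ωh)
    (hωωh : ω ≤ ωh) {ΦY : ℕ → ℝ → lp (fun _ : ι => ℂ) ∞ → lp (fun _ : Bg × C.Dom => ℂ) ∞} {r B₀ θ ℓ : ℝ} (hr : 0 < r)
    (hB₀ : 0 ≤ B₀) (hθ0 : 0 < θ) (hθ1 : θ < 1) (hℓ : 0 ≤ ℓ)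
    (hΦd : ∀ k, ∀ g ∈ W, DifferentiableOn ℂ (ΦY k (g k)) (ball (0 : lp (fun _ : ι => ℂ) ∞) r))
    (hΦb : ∀ k, ∀ g ∈ W, MapsTo (ΦY k (g k)) (ball (0 : lp (fun _ : ι => ℂ) ∞) r) (closedBall 0 B₀))
    (hreal : ∀ k, ∀ g ∈ W, ∀ s ∈ W, reading (wt k) (T k s (E g)) ∈ ball (0 : lp (fun _ : ι => ℂ) ∞) r →
      ∀ (U : Bg) (X : C.Dom), (ΦY k (s k) (reading (wt k) (T k s (E g))) : Bg × C.Dom → ℂ) (U, X) =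
        ((Real.exp (κ * C.d X) * restrictScale (k + 1) (Ψ k (s k) (T k s (E g))) U X : ℝ) : ℂ))
    (hroom : ωh * r + τbar * B₀ ≤ θ * r) (hlam : ∀ k, lam k ≤ ℓ) :
    NE9 E W κ (prodModuli (1 / (1 - θ ^ 2) * ℓ) fun _ => θ) ∧
      FadingMemory (1 / (1 - θ ^ 2) * ℓ / θ) θ (prodModuli (1 / (1 - θ ^ 2) * ℓ) fun _ => θ) :=
  ne9_and_fadingMemory_of_holoSlice_injRead_SP h0 hAdm hres hadd hloc hstep hfac hlast hsmul hne hwt hτ hω hωh hωωh hτbar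
    (fun j n s _ => norm_RdAmb_le_geometric_sharp (τ_geom hτ) j n s) hr hB₀ hθ0 hθ1 hℓ hΦd hΦb hreal hroom hlam

/-! ## §4 Junction (an `example`, not a declaration): the Earle–Hamilton END of record IS §1 at the Earle–Hamilton chain -/

/-- JUNCTION.  `NE9FutureProfileEndOfRecordSharp.ne9_and_fadingMemory_of_holoSlice_injRead` (p255390 §2: binders VERBATIM, conclusion
at `2∕(1−θ)`, `2θ∕(1+θ)`) is §1 at the tree's Earle–Hamilton kernel `NE9EarleHamiltonChain.chainLipschitz_of_holoSelfMaps` ∘ K2♭'s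
`holoSelfMaps_step` — checked here by `exact` as an `example` (the gate's `dedup.landed` rule forbids re-declaring the landed statement).
So the EH END and the SP END of record are the two instances of ONE chain-generic END. [folklore] -/
example (h0 : ∀ g ∈ W, ∀ (U : Bg) (X : C.Dom), C.scale X = 0 → E g U X = 0)
    (hAdm : AdmissibleTerms E W Adm) (hres : AdmRestrict Adm) (hadd : ChannelAdditive Adm T) (hloc : ChannelLocal Adm T)
    (hstep : ChannelSizeAtStepNN Adm T κ wt τ) (hfac : Factorises E W T Ψ) {lam : ℕ → ℝ}
    (hlast : LastCouplingLipschitz E W T Ψ κ lam)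
    (hsmul : ∀ (c : ℝ), ∀ H ∈ Adm, c • H ∈ Adm) (hne : Adm.Nonempty) (hwt : ∀ m y, 0 < wt m y)
    (hτ : ∀ k j, j ≤ k → 0 ≤ τ k j ∧ τ k j ≤ τbar * ω ^ (k - j)) (hω : 0 ≤ ω) (hωh : 0 < ωh) (hωωh : ω ≤ ωh)
    {τ₀ : ℝ} (hτ₀pos : 0 < τ₀)
    (hRd : ∀ (j n : ℕ), ∀ s ∈ W,
      ‖RdAmb (κ := κ) hadd hres hstep hAdm.2 hsmul hne hwt (τ_nonneg hτ) (j + n) j s‖ ≤ τ₀ * ω ^ n)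
    {ΦY : ℕ → ℝ → lp (fun _ : ι => ℂ) ∞ → lp (fun _ : Bg × C.Dom => ℂ) ∞} {r B₀ θ ℓ : ℝ} (hr : 0 < r)
    (hB₀ : 0 ≤ B₀) (hθ0 : 0 < θ) (hθ1 : θ < 1) (hℓ : 0 ≤ ℓ)
    (hΦd : ∀ k, ∀ g ∈ W, DifferentiableOn ℂ (ΦY k (g k)) (ball (0 : lp (fun _ : ι => ℂ) ∞) r))
    (hΦb : ∀ k, ∀ g ∈ W, MapsTo (ΦY k (g k)) (ball (0 : lp (fun _ : ι => ℂ) ∞) r) (closedBall 0 B₀))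
    (hreal : ∀ k, ∀ g ∈ W, ∀ s ∈ W, reading (wt k) (T k s (E g)) ∈ ball (0 : lp (fun _ : ι => ℂ) ∞) r →
      ∀ (U : Bg) (X : C.Dom), (ΦY k (s k) (reading (wt k) (T k s (E g))) : Bg × C.Dom → ℂ) (U, X) =
        ((Real.exp (κ * C.d X) * restrictScale (k + 1) (Ψ k (s k) (T k s (E g))) U X : ℝ) : ℂ))
    (hroom : ωh * r + τ₀ * B₀ ≤ θ * r) (hlam : ∀ k, lam k ≤ ℓ) :
    NE9 E W κ (prodModuli (2 / (1 - θ) * ℓ) fun _ => 2 * θ / (1 + θ)) ∧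
      FadingMemory (2 / (1 - θ) * ℓ / (2 * θ / (1 + θ))) (2 * θ / (1 + θ))
        (prodModuli (2 / (1 - θ) * ℓ) fun _ => 2 * θ / (1 + θ)) :=
  ne9_and_fadingMemory_of_holoSlice_injRead_of_chain h0 hAdm hres hadd hloc hstep hfac hlast hsmul hne hwt hτ hω hωh hωωh
    hτ₀pos hRd hr hB₀ hθ1 hℓ (div_nonneg zero_le_two (by linarith)) (div_pos (by linarith) (by linarith)) hΦb hreal hroom
    (chainLipschitz_of_holoSelfMaps hr hθ0 hθ1
      (holoSelfMaps_step hτ₀pos.le hωh.le hΦd hΦb (fun k => norm_injRead_le _ hτ₀pos.le hω hωh hωωh hRd k) hroom))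
    hlam

end Record

/-! ## §5 Arithmetic at the room's print-letter reading (asserted of nothing) -/

/-- ARITHMETIC AT THE ROOM's print-letter READING (PRICING-NE9 v8 §B (B8-3) ∕ ROUTES-NE9 §L1.0: box slack `S = 24∕13`, `ω̂ = 1∕13`
⇒ `θ = ω̂ + (1 − ω̂)∕S = 15∕26`): the END of record's rate letter moves from the Earle–Hamilton `2θ∕(1+θ) = 30∕41 ≈ 0.7317` to the
Schwarz–Pick `θ = 15∕26 ≈ 0.5769`, the prefactor from `2∕(1−θ) = 52∕11` to `1∕(1−θ²) = 676∕451`; both rates `< 1` exactly when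
`S > 1` (life region unchanged).  A READING of [II] p. 8 l. 9–10, asserted of nothing. [folklore] -/
example : (1 : ℝ) / 13 + (1 - 1 / 13) / (24 / 13) = 15 / 26 ∧ 2 * ((15 : ℝ) / 26) / (1 + 15 / 26) = 30 / 41 ∧
    (15 : ℝ) / 26 < 30 / 41 ∧ (2 : ℝ) / (1 - 15 / 26) = 52 / 11 ∧ (1 : ℝ) / (1 - (15 / 26) ^ 2) = 676 / 451 ∧
    (676 : ℝ) / 451 < 52 / 11 := by norm_num

end Summit.QuantumFields.BalabanUV.T4Continuum.NE9FutureProfileEndOfRecordSP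

end
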